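import Mathlib
import HarnessLib.Audit
import Summits.PneNP.PneNP.Theorems.PstarSlackAssembly
import Summits.PneNP.PneNP.Theorems.PstarSlackTwoDirty

/-!
# The census node past slack two with a dirty chord (ROUND-24, O1; memo g25 §49.4)

FRONTIER range-avoidance ladder, rung F-N3, ROUND 24 (cell `pnp-ideate`, prover-2 memo `g25/O1-XORSPLIT-g25.md` §49; typed targets
`PstarCoreBoundTargets.TerminalFive` / `TerminalPeelable` (p646951); restricted-model proof complexity — nothing here bears on `P` versus `NP`).

`PstarSlackAssembly.MenuCriterionBoundSlackTwo` lets the census assume, for X-connected cores, boundary slack `t ≥ 2`.  With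
`PstarSlackTwoDirty.no_centre_at_slack_two_dirty` the X-connected cores of slack EXACTLY two that carry a dirty chord are centre-free as well, so the
node shrinks once more: **`MenuCriterionBoundSlackTwoClean`** asks the census only for the terminal cores with a centre that are not X-connected, or
have slack `≥ 3`, or have slack `2` and ALL chords outside-gated; `terminalFive_of_menuBoundSlackTwoClean : TerminalFiveA → node → TerminalFive`,
`terminalPeelable_of_menuBoundSlackTwoClean`, and the comparison `menuCriterionBoundSlackTwoClean_of_slackTwo`.
-/

set_option linter.dupNamespace false -- `Summit.PneNP.PneNP.…`: summit = sub-problem name (D-0017 single-conjunct layout)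

open Finset Literature.Computability.Complexity
open Summit.PneNP.PneNP.Theorems.PstarTyped (Typed)
open Summit.PneNP.PneNP.Theorems.PstarSALevel (varSet bdry BoundaryExpanding SimpleOverlap)
open Summit.PneNP.PneNP.Theorems.PstarXCore (xverts)
open Summit.PneNP.PneNP.Theorems.PstarCoreBound (XorClosed)
open Summit.PneNP.PneNP.Theorems.PstarChordRepair (IsChord)
open Summit.PneNP.PneNP.Theorems.PstarCoreBoundTargets (Terminal TerminalFive TerminalFiveA TerminalPeelable nonchords nonchords_subset mem_nonchords
  terminalPeelable_of_terminalFive)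
open Summit.PneNP.PneNP.Theorems.PstarSharingBound (sharedSlots)
open Summit.PneNP.PneNP.Theorems.PstarChordBridgeTools (xpdeg)
open Summit.PneNP.PneNP.Theorems.PstarChordBridgeCentre (exists_maximal_peelable_sup)
open Summit.PneNP.PneNP.Theorems.PstarChordReadOutside (OutsideGated)
open Summit.PneNP.PneNP.Theorems.PstarSliceGenericCriterion (NoShortCoincidence)
open Summit.PneNP.PneNP.Theorems.PstarCleanChordCount (exists_clean_chords)
open Summit.PneNP.PneNP.Theorems.PstarTerminalPeelableTwelve (exists_centre_of_not_peelable)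
open Summit.PneNP.PneNP.Theorems.PstarNoFreeVertex (Covered covered_of_terminal)
open Summit.PneNP.PneNP.Theorems.PstarHangingForest (Anchored anchored_of_terminal)
open Summit.PneNP.PneNP.Theorems.PstarCleanCut (smallCriterion_of_crossing)
open Summit.PneNP.PneNP.Theorems.PstarCleanCutAssembly (false_of_cleanCut_two SkConnected NoTwoCrossings)
open Summit.PneNP.PneNP.Theorems.PstarTwoCleanExact (MenuGeneric false_of_two_clean_exact)
open Summit.PneNP.PneNP.Theorems.PstarMenuCriterion (NoSmallPathSumSubcoreExact channelMenus subset_of_mem_channelMenus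
  noSmallPathSumSubcoreExact_of_subset noShortCoincidence_anti menuGeneric_of_criterion)
open Summit.PneNP.PneNP.Theorems.PstarSkeletonSpan (XConnected)
open Summit.PneNP.PneNP.Theorems.PstarSlackOneCentre (no_centre_at_slack_one)
open Summit.PneNP.PneNP.Theorems.PstarSlackAssembly (no_centre_at_slack_zero MenuCriterionBoundSlackTwo)
open Summit.PneNP.PneNP.Theorems.PstarSlackTwoDirty (no_centre_at_slack_two_dirty)

namespace Summit.PneNP.PneNP.Theorems.PstarSlackAssemblyTwo

variable {n m : ℕ}

/-- **`MenuCriterionBoundSlackTwoClean` (OPEN, census-type)**: `MenuCriterionBound` restricted to the terminal cores with a centre that are not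
X-connected, or have boundary slack at least three, or have slack exactly two and every chord outside-gated.  FRONTIER. -/
@[conjecture] def MenuCriterionBoundSlackTwoClean : Prop :=
  ∀ (n m r : ℕ) (I : LocalMap 4 n m), I.IsPure xorAndPred → Typed I → SimpleOverlap I → BoundaryExpanding r I →
    ∀ (y : Fin m → Bool) (J₀ : Finset (Fin m)) (w₁ w₂ : Finset (Fin n) × Finset (Fin m) × Bool), Terminal I r y J₀ w₁ w₂ →
      (∃ S ⊆ J₀, S.Nonempty ∧ (∀ w ∈ xverts I S, 2 ≤ xpdeg I S w) ∧ ∀ f ∈ S, ¬ IsChord I J₀ f) →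
      Covered I J₀ (w₁.2.1 ∪ w₂.2.1) → Anchored I J₀ (w₁.2.1 ∪ w₂.2.1) → NoTwoCrossings I J₀ (w₁.2.1 ∪ w₂.2.1) →
      (XConnected I J₀ → 3 * J₀.card + 3 ≤ 2 * (bdry I J₀).card ∨
        (2 * (bdry I J₀).card = 3 * J₀.card + 2 ∧ ∀ c ∈ J₀, IsChord I J₀ c → OutsideGated I J₀ (w₁.2.1 ∪ w₂.2.1) c)) →
      ∃ ℬ ⊆ J₀, ℬ.card + 2 ≤ (sharedSlots I J₀).card ∧
        ∀ c ∈ J₀, c ∉ ℬ → IsChord I J₀ c → OutsideGated I J₀ (w₁.2.1 ∪ w₂.2.1) c → SkConnected I J₀ (w₁.2.1 ∪ w₂.2.1) c →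
          ∀ G ∈ channelMenus I J₀ w₁ w₂, NoSmallPathSumSubcoreExact I r y J₀ c G ∧ NoShortCoincidence I J₀ c G

/-- The new node is weaker than `MenuCriterionBoundSlackTwo`. -/
theorem menuCriterionBoundSlackTwoClean_of_slackTwo (h : MenuCriterionBoundSlackTwo) : MenuCriterionBoundSlackTwoClean := by
  intro n m r I hI hT hS hB y J₀ w₁ w₂ ht hc hcov hanc hN2 hx
  refine h n m r I hI hT hS hB y J₀ w₁ w₂ ht hc hcov hanc hN2 fun hconn => ?_
  rcases hx hconn with h3 | ⟨h2, -⟩ <;> omega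

/-- **THE CORE BOUND FROM O2 AND THE NODE PAST SLACK TWO WITH A DIRTY CHORD** — the strong induction of `terminalFive_of_menuBound`, the X-connected
structures of slack `0`, `1`, and `2` with a dirty chord excluded by name. -/
theorem terminalFive_of_menuBoundSlackTwoClean (hO2 : TerminalFiveA) (hb : MenuCriterionBoundSlackTwoClean) : TerminalFive := by
  classical
  suffices H : ∀ (k n m r : ℕ) (I : LocalMap 4 n m), I.IsPure xorAndPred → Typed I → SimpleOverlap I → BoundaryExpanding r I →
      ∀ (y : Fin m → Bool) (J₀ : Finset (Fin m)) (w₁ w₂ : Finset (Fin n) × Finset (Fin m) × Bool), Terminal I r y J₀ w₁ w₂ →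
        J₀.card = k → J₀.card ≤ 5 from
    fun n m r I hI hT hS hB y J₀ w₁ w₂ ht => H _ n m r I hI hT hS hB y J₀ w₁ w₂ ht rfl
  intro k
  induction k using Nat.strong_induction_on with
  | _ k ih =>
    intro n m r I hI hT hS hB y J₀ w₁ w₂ ht hk
    by_cases hP : PstarChordBridgeCotree.Peelable I (nonchords I J₀)
    · obtain ⟨F, hS₀F, hFJ, hPF, hmax⟩ := exists_maximal_peelable_sup I (nonchords_subset I J₀) hP
      refine hO2 n m r I hI hT hS hB y J₀ w₁ w₂ ht F hFJ hPF hmax fun e he => ?_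
      rw [mem_sdiff] at he
      by_contra hc
      exact he.2 (hS₀F ((mem_nonchords I).2 ⟨he.1, hc⟩))
    · exfalso
      obtain ⟨S, hSJ, hne, hL, hnc⟩ := exists_centre_of_not_peelable I hP
      have hdisj : Disjoint J₀ (w₁.2.1 ∪ w₂.2.1) := disjoint_union_right.2 ⟨ht.2.2.2.1, ht.2.2.2.2.1⟩
      set 𝒢 := w₁.2.1 ∪ w₂.2.1 with h𝒢
      have hIH : ∀ c ∈ J₀, ∀ K₀ ⊆ J₀.erase c, ∀ d₁ d₂ : Finset (Fin n) × Finset (Fin m) × Bool, Terminal I r y K₀ d₁ d₂ → K₀.card ≤ 5 := by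
        intro c hc K₀ hK₀ d₁ d₂ ht₀
        have hlt : K₀.card < k := by
          rw [← hk]
          exact lt_of_le_of_lt (card_le_card hK₀) (card_erase_lt_of_mem hc)
        exact ih K₀.card hlt n m r I hI hT hS hB y K₀ d₁ d₂ ht₀ rfl
      -- the slack layers `0` and `1` of X-connected cores carry no centre
      have hslack : XConnected I J₀ → 3 * J₀.card + 3 ≤ 2 * (bdry I J₀).card ∨
          (2 * (bdry I J₀).card = 3 * J₀.card + 2 ∧ ∀ c ∈ J₀, IsChord I J₀ c → OutsideGated I J₀ (w₁.2.1 ∪ w₂.2.1) c) := by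
        intro hconn
        have hexp : 3 * J₀.card ≤ 2 * (bdry I J₀).card := hB J₀ ht.2.2.1.le
        by_cases h3 : 3 * J₀.card + 3 ≤ 2 * (bdry I J₀).card
        · exact Or.inl h3
        right
        by_cases h0 : 2 * (bdry I J₀).card = 3 * J₀.card
        · exact absurd ⟨S, hSJ, hne, hL, hnc⟩ (no_centre_at_slack_zero hI hT hS hB ht hIH hconn h0)
        by_cases h1 : 2 * (bdry I J₀).card = 3 * J₀.card + 1
        · exact absurd ⟨S, hSJ, hne, hL, hnc⟩ (no_centre_at_slack_one hI hT hS hB ht hIH hconn h1)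
        have h2 : 2 * (bdry I J₀).card = 3 * J₀.card + 2 := by omega
        refine ⟨h2, fun c hc hch => ?_⟩
        by_contra hO
        exact no_centre_at_slack_two_dirty hI hT hS hB ht hIH hconn h2 ⟨c, hc, hch, hO⟩ ⟨S, hSJ, hne, hL, hnc⟩
      have hN2 : NoTwoCrossings I J₀ 𝒢 := fun W e₁ e₂ he₁ he₂ hne hc₁ hc₂ hcut =>
        false_of_cleanCut_two hI hT hS hB ht hIH hcut he₁ he₂ hne hc₁ hc₂
      obtain ⟨ℬ, -, hℬ, hgood⟩ := hb n m r I hI hT hS hB y J₀ w₁ w₂ ht ⟨S, hSJ, hne, hL, hnc⟩ (covered_of_terminal hI hT hS hB ht)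
        (anchored_of_terminal hI hT hS hB ht) hN2 hslack
      obtain ⟨𝒞, h𝒞J, hch, hO, hcard⟩ := exists_clean_chords hB ht
      have hU : 1 < (𝒞 \ ℬ).card := by
        have := le_card_sdiff ℬ 𝒞
        omega
      obtain ⟨a, ha, b, hb', hab⟩ := one_lt_card.1 hU
      obtain ⟨ha𝒞, haℬ⟩ := mem_sdiff.1 ha
      obtain ⟨hb𝒞, hbℬ⟩ := mem_sdiff.1 hb'
      have hcrit : ∀ c ∈ 𝒞, c ∉ ℬ → ∀ G ∈ channelMenus I J₀ w₁ w₂,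
          NoSmallPathSumSubcoreExact I r y J₀ c G ∧ NoShortCoincidence I J₀ c G := by
        intro c hc hcℬ G hG
        by_cases hsk : SkConnected I J₀ 𝒢 c
        · exact hgood c (h𝒞J hc) hcℬ (hch c hc) (hO c hc) hsk G hG
        · unfold PstarCleanCutAssembly.SkConnected at hsk
          push Not at hsk
          obtain ⟨W, hcW, hcut⟩ := hsk
          obtain ⟨hA, hBc⟩ := smallCriterion_of_crossing (y := y) (r := r) hI hT hS hB hdisj (fun f hf hcf => hcut f hf hcf) hcW
          exact ⟨noSmallPathSumSubcoreExact_of_subset hA (subset_of_mem_channelMenus hG),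
            noShortCoincidence_anti hBc (subset_of_mem_channelMenus hG)⟩
      have hgen : ∀ c ∈ 𝒞, c ∉ ℬ → MenuGeneric I y J₀ c w₁ w₂ := fun c hc hcℬ =>
        menuGeneric_of_criterion hI hT hS hB ht (h𝒞J hc) (hIH c (h𝒞J hc)) (hcrit c hc hcℬ)
      exact false_of_two_clean_exact hI hT hS hB ht (h𝒞J ha𝒞) (h𝒞J hb𝒞) hab (hch a ha𝒞) (hch b hb𝒞) (hO a ha𝒞) (hO b hb𝒞)
        (hgen a ha𝒞 haℬ) (hgen b hb𝒞 hbℬ)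

/-- **O1 from the same inputs.** -/
theorem terminalPeelable_of_menuBoundSlackTwoClean (hO2 : TerminalFiveA) (hb : MenuCriterionBoundSlackTwoClean) : TerminalPeelable :=
  terminalPeelable_of_terminalFive (terminalFive_of_menuBoundSlackTwoClean hO2 hb)

end Summit.PneNP.PneNP.Theorems.PstarSlackAssemblyTwo
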